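import Summits.Ventures.Crystal3D.Theorems.StickyWulffConstantGenericWallFloorHexSteering
import Summits.Ventures.Crystal3D.Theorems.StickyWulffConstantGenericWallFloorPlateClimb
import HarnessLib

/-!
# The plate slide: climbing a terminal twin plate INSIDE a tilted tube

HONEST FRAMING. Venture `Summits/Ventures/Crystal3D` (cell `crystal3d-full`), helper for the crux
`GenericWallFloor` (stmt-Ventures-19480) of `route-Ventures-StickyWulffConstant`, REGISTERED line `WallLedgerG`,
open stub `stub_twoSlabAdhesion` (general fillings; the `Σ3ⁿ` chain pairs, refusal walks).  Rung credit only;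
F-C1 not moved.

`twinDozen_plateSlide_payer`: the `h`-free replacement of `twinDozen_plateClimb_payer`.  The tube axis is a
line `a + ℝ z` whose unit direction `z` lies IN the plate (`⟪z, n⟫ = 0`) and rises (`⟪z, e₃⟫ ≥ σ > 0`,
`e₃ = ⟪e₃, z⟫ z + ⟪e₃, n⟫ n`); the lateral deviation of a point `y` is `r(y) = (y − a) − ⟪y − a, z⟫ z`.  From a
twin-dozen ball `e` of a frame `G` with `G(Λ₀) ≠ A₂(Λ₀)` (top sample `P₂ ⊆ Λ₂` complete and sealed) with
`‖r(e)‖² ≤ 289`, the walk along in-plane slots chosen by `exists_inPlane_steering_slot` /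
`exists_inPlane_slot_ge` (rise `≥ 1/5` along `z`, lateral correction towards the axis whenever the in-plane
deviation is `≥ 5/2`) keeps `‖r‖² ≤ 302` and reaches, before the deep top window (impossible for a twin dozen
of `G`, own polar slots + `movedFcc_eq_of_exact_neighbours_top_sf`), a step where terrace propagation fails:
an UNSATURATED ball within lateral distance `20` of the axis, at height in `[a₂ − 21, h + R₀ + 4)`.
WHAT THIS IS NOT: not the stub; no counting; F-C1 not moved.
-/

noncomputable section

namespace Summit.Ventures.Crystal3D.Theorems

open Summit.Ventures.Crystal3D Finset
open Literature.MathematicalPhysics.StatisticalMechanics (fccStacking)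
open scoped InnerProductSpace

/-- Lateral deviation is orthogonal to the axis. -/
theorem inner_lateral_axis (y a z : EuclideanSpace ℝ (Fin 3)) (hz : ‖z‖ = 1) :
    ⟪y - a - ⟪y - a, z⟫_ℝ • z, z⟫_ℝ = 0 := by
  rw [inner_sub_left, real_inner_smul_left, real_inner_self_eq_norm_sq, hz]; ring

/-- Lateral deviation after a step `d`. -/
theorem lateral_dev_add (y a z d : EuclideanSpace ℝ (Fin 3)) :
    (y + d) - a - ⟪(y + d) - a, z⟫_ℝ • z = (y - a - ⟪y - a, z⟫_ℝ • z) + (d - ⟪d, z⟫_ℝ • z) := by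
  have : (y + d) - a = (y - a) + d := by abel
  rw [this, inner_add_left, add_smul]; abel

/-- The perpendicular part of a unit step has norm at most one: `‖d − ⟪d,z⟫z‖² = 1 − ⟪d,z⟫²`. -/
theorem norm_sq_perp_step {d z : EuclideanSpace ℝ (Fin 3)} (hd : ‖d‖ = 1) (hz : ‖z‖ = 1) :
    ‖d - ⟪d, z⟫_ℝ • z‖ ^ 2 = 1 - ⟪d, z⟫_ℝ ^ 2 := by
  rw [norm_sub_sq_real, hd, norm_smul, hz, mul_one, real_inner_smul_right, Real.norm_eq_abs, sq_abs]; ring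

/-- Height decomposition along a rising in-plate axis: if `e₃ = ⟪e₃,z⟫ z + ⟪e₃,n⟫ n` then a point's height is
`a₂ + ⟪y − a, z⟫⟪z, e₃⟫ + ⟪r(y), n⟫⟪n, e₃⟫`. -/
theorem height_eq_of_axis (y a z n : EuclideanSpace ℝ (Fin 3)) (hzn : ⟪z, n⟫_ℝ = 0)
    (he : EuclideanSpace.single (2 : Fin 3) (1 : ℝ) =
      ⟪EuclideanSpace.single (2 : Fin 3) (1 : ℝ), z⟫_ℝ • z + ⟪EuclideanSpace.single (2 : Fin 3) (1 : ℝ), n⟫_ℝ • n) :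
    y 2 = a 2 + ⟪y - a, z⟫_ℝ * ⟪EuclideanSpace.single (2 : Fin 3) (1 : ℝ), z⟫_ℝ +
      ⟪y - a - ⟪y - a, z⟫_ℝ • z, n⟫_ℝ * ⟪EuclideanSpace.single (2 : Fin 3) (1 : ℝ), n⟫_ℝ := by
  have h1 : y 2 - a 2 = ⟪y - a, EuclideanSpace.single (2 : Fin 3) (1 : ℝ)⟫_ℝ := by
    rw [EuclideanSpace.inner_single_right]; simp
  have h3 : ⟪y - a - ⟪y - a, z⟫_ℝ • z, n⟫_ℝ = ⟪y - a, n⟫_ℝ := by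
    rw [inner_sub_left, real_inner_smul_left, hzn, mul_zero, sub_zero]
  have h2 : ⟪y - a, EuclideanSpace.single (2 : Fin 3) (1 : ℝ)⟫_ℝ =
      ⟪EuclideanSpace.single (2 : Fin 3) (1 : ℝ), z⟫_ℝ * ⟪y - a, z⟫_ℝ +
        ⟪EuclideanSpace.single (2 : Fin 3) (1 : ℝ), n⟫_ℝ * ⟪y - a, n⟫_ℝ := by
    conv_lhs => rw [he]
    rw [inner_add_right, real_inner_smul_right, real_inner_smul_right]
  rw [h3]
  linarith

open scoped Classical in
/-- **The plate slide.**  See the module docstring. -/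
theorem twinDozen_plateSlide_payer {δ : ℝ} (hg : KissingGap δ) (hc : KissingClassification δ)
    (A₂ : EuclideanSpace ℝ (Fin 3) ≃ₗᵢ[ℝ] EuclideanSpace ℝ (Fin 3)) (t₂ : EuclideanSpace ℝ (Fin 3))
    (X P₂ : Finset (EuclideanSpace ℝ (Fin 3))) (R₀ h ρ : ℝ) (hR₀ : 3 ≤ R₀) (hρ : R₀ ≤ ρ)
    (hX : ∀ p ∈ X, ∀ q ∈ X, p ≠ q → 1 ≤ dist p q) (hP₂X : P₂ ⊆ X)
    (hcell : ∀ p ∈ X, p 2 ≤ h + 2 * R₀)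
    (hP₂ : ∀ p, p ∈ P₂ ↔ (p ∈ (fun q => A₂ q + t₂) '' fccStacking 1 (Real.sqrt (2 / 3)) ∧
      h + R₀ ≤ p 2 ∧ p 2 ≤ h + 2 * R₀ ∧ p 0 ^ 2 + p 1 ^ 2 ≤ ρ ^ 2))
    (G : EuclideanSpace ℝ (Fin 3) ≃ₗᵢ[ℝ] EuclideanSpace ℝ (Fin 3))
    (hGne : G '' fccStacking 1 (Real.sqrt (2 / 3)) ≠ A₂ '' fccStacking 1 (Real.sqrt (2 / 3)))
    {n : EuclideanSpace ℝ (Fin 3)} (hn : ‖n‖ = 1)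
    (hmenu : ∀ w ∈ fccSlots, ⟪G w, n⟫_ℝ = 0 ∨ ⟪G w, n⟫_ℝ = Real.sqrt (2 / 3) ∨ ⟪G w, n⟫_ℝ = -Real.sqrt (2 / 3))
    {z : EuclideanSpace ℝ (Fin 3)} (hz : ‖z‖ = 1) (hzn : ⟪z, n⟫_ℝ = 0)
    {σ : ℝ} (hσ : 0 < σ) (hσz : σ ≤ ⟪z, EuclideanSpace.single (2 : Fin 3) (1 : ℝ)⟫_ℝ)
    (he₃ : EuclideanSpace.single (2 : Fin 3) (1 : ℝ) =
      ⟪EuclideanSpace.single (2 : Fin 3) (1 : ℝ), z⟫_ℝ • z + ⟪EuclideanSpace.single (2 : Fin 3) (1 : ℝ), n⟫_ℝ • n)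
    (a : EuclideanSpace ℝ (Fin 3))
    (hlat : ∀ y ∈ X, ‖y - a - ⟪y - a, z⟫_ℝ • z‖ ≤ 20 → h + R₀ + 2 ≤ y 2 → y 0 ^ 2 + y 1 ^ 2 ≤ (ρ - 2) ^ 2)
    {e : EuclideanSpace ℝ (Fin 3)} (he : e ∈ X) (he₂ : e 2 < h + R₀ + 2) (hes : 0 ≤ ⟪e - a, z⟫_ℝ)
    (her : ‖e - a - ⟪e - a, z⟫_ℝ • z‖ ^ 2 ≤ 289)
    (hown : ∀ w ∈ fccSlots, ⟪G w, n⟫_ℝ ≤ 0 → e + G w ∈ X)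
    (hfar : ∀ w ∈ fccSlots, 0 < ⟪G w, n⟫_ℝ → e + G w ∉ X) :
    ∃ q ∈ X, (X.filter fun y => dist q y = 1).card ≠ 12 ∧ ‖q - a - ⟪q - a, z⟫_ℝ • z‖ ≤ 20 ∧
      a 2 - 21 ≤ q 2 ∧ q 2 < h + R₀ + 4 := by
  set e₃ : EuclideanSpace ℝ (Fin 3) := EuclideanSpace.single (2 : Fin 3) (1 : ℝ) with he₃def
  have he₃n : ‖e₃‖ = 1 := by rw [he₃def, PiLp.norm_single, norm_one]
  have hrpos : 0 < Real.sqrt (2 / 3) := Real.sqrt_pos.2 (by norm_num)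
  set r : EuclideanSpace ℝ (Fin 3) → EuclideanSpace ℝ (Fin 3) := fun y => y - a - ⟪y - a, z⟫_ℝ • z with hrdef
  have hr_apply : ∀ y, r y = y - a - ⟪y - a, z⟫_ℝ • z := fun y => rfl
  have hrz : ∀ y, ⟪r y, z⟫_ℝ = 0 := fun y => inner_lateral_axis y a z hz
  have hr_add : ∀ y d, r (y + d) = r y + (d - ⟪d, z⟫_ℝ • z) := fun y d => lateral_dev_add y a z d
  have hz2 : ⟪z, e₃⟫_ℝ = ⟪e₃, z⟫_ℝ := real_inner_comm _ _
  have hne₃ : |⟪n, e₃⟫_ℝ| ≤ 1 := by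
    have := abs_real_inner_le_norm n e₃; rwa [hn, he₃n, one_mul] at this
  have hze₃pos : 0 < ⟪z, e₃⟫_ℝ := lt_of_lt_of_le hσ hσz
  -- height of a point in terms of axis coordinate and lateral deviation
  have height : ∀ y, y 2 = a 2 + ⟪y - a, z⟫_ℝ * ⟪z, e₃⟫_ℝ + ⟪r y, n⟫_ℝ * ⟪n, e₃⟫_ℝ := by
    intro y
    rw [real_inner_comm e₃ z, real_inner_comm e₃ n]
    exact height_eq_of_axis y a z n hzn he₃
  -- the slide constants
  set μ : ℝ := ⟪r e, n⟫_ℝ with hμ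
  set B : ℝ := ‖r e - μ • n‖ ^ 2 + 13 with hB
  set S : ℝ := (h + 2 * R₀ + 20 - a 2) / σ with hS
  have pyth : ∀ y, ⟪r y, n⟫_ℝ = μ → ‖r y‖ ^ 2 = ‖r y - μ • n‖ ^ 2 + μ ^ 2 := by
    intro y hy
    have e1 : r y = (r y - μ • n) + μ • n := by abel
    have horth : ⟪r y - μ • n, μ • n⟫_ℝ = 0 := by
      rw [real_inner_smul_right, inner_sub_left, hy, real_inner_smul_left, real_inner_self_eq_norm_sq, hn]; ring
    conv_lhs => rw [e1]
    rw [norm_add_sq_real, horth, norm_smul, hn, mul_one, Real.norm_eq_abs, sq_abs]; ring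
  have her' : ‖r e‖ ^ 2 ≤ 289 := her
  have hBμ : B + μ ^ 2 ≤ 302 := by
    have := pyth e rfl
    rw [hB]; linarith
  have hB13 : 13 ≤ B := by rw [hB]; linarith [sq_nonneg ‖r e - μ • n‖]
  -- in-plane slots are differences of far slots, so terrace propagation applies to any of them
  obtain ⟨u₁, hu₁, u₂, hu₂, u₃, hu₃, hn₁, hn₂, hn₃, i12, i13, i23, hind, -⟩ := exists_far_frame G hn hmenu
  have p₁ : 0 < ⟪G u₁, n⟫_ℝ := by rw [hn₁]; exact hrpos
  have p₂ : 0 < ⟪G u₂, n⟫_ℝ := by rw [hn₂]; exact hrpos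
  have p₃ : 0 < ⟪G u₃, n⟫_ℝ := by rw [hn₃]; exact hrpos
  have d12 : u₁ ≠ u₂ := by
    intro h0; rw [h0, real_inner_self_eq_norm_sq, norm_eq_one_of_mem_fccSlots hu₂] at i12; norm_num at i12
  have d13 : u₁ ≠ u₃ := by
    intro h0; rw [h0, real_inner_self_eq_norm_sq, norm_eq_one_of_mem_fccSlots hu₃] at i13; norm_num at i13
  have d23 : u₂ ≠ u₃ := by
    intro h0; rw [h0, real_inner_self_eq_norm_sq, norm_eq_one_of_mem_fccSlots hu₃] at i23; norm_num at i23
  have propagate' : ∀ y ∈ X, (∀ w ∈ fccSlots, ⟪G w, n⟫_ℝ ≤ 0 → y + G w ∈ X) →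
      (∀ w ∈ fccSlots, 0 < ⟪G w, n⟫_ℝ → y + G w ∉ X) → ∀ w ∈ fccSlots, ⟪G w, n⟫_ℝ = 0 →
      (X.filter fun q => dist (y + G w) q = 1).card = 12 →
      (∀ q ∈ X, dist (y + G w) q = 1 → q ≠ y + G w → (X.filter fun q' => dist q q' = 1).card = 12) →
      (∀ w' ∈ fccSlots, ⟪G w', n⟫_ℝ ≤ 0 → y + G w + G w' ∈ X) ∧
      (∀ w' ∈ fccSlots, 0 < ⟪G w', n⟫_ℝ → y + G w + G w' ∉ X) := by
    intro y hy hown_y hfar_y w hw hw0 h12 hnb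
    have key : ∀ {uᵢ uⱼ : EuclideanSpace ℝ (Fin 3)}, uᵢ ∈ fccSlots → uⱼ ∈ fccSlots → uᵢ ≠ uⱼ →
        0 < ⟪G uᵢ, n⟫_ℝ → 0 < ⟪G uⱼ, n⟫_ℝ → w = uᵢ - uⱼ →
        (∀ w' ∈ fccSlots, ⟪G w', n⟫_ℝ ≤ 0 → y + G w + G w' ∈ X) ∧
        (∀ w' ∈ fccSlots, 0 < ⟪G w', n⟫_ℝ → y + G w + G w' ∉ X) := by
      intro uᵢ uⱼ hi hj hij hip hjp hwij
      subst hwij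
      obtain ⟨h1, -, h3⟩ := twinDozen_inPlane_propagate hg hc hX G hn hmenu hy hown_y hfar_y hi hj hij hip hjp h12
        (y + G (uᵢ - uⱼ)) hnb
      exact ⟨h1, h3⟩
    rcases inPlane_slot_eq_sub_far G hn hu₁ hu₂ hu₃ hn₁ hn₂ hn₃ i12 i13 i23 hind hw hw0 with
      h0 | h0 | h0 | h0 | h0 | h0
    · exact key hu₁ hu₂ d12 p₁ p₂ h0
    · exact key hu₂ hu₁ d12.symm p₂ p₁ h0
    · exact key hu₁ hu₃ d13 p₁ p₃ h0
    · exact key hu₃ hu₁ d13.symm p₃ p₁ h0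
    · exact key hu₂ hu₃ d23 p₂ p₃ h0
    · exact key hu₃ hu₂ d23.symm p₃ p₂ h0
  -- own polar slots, for the deep-top contradiction
  have hindneg : LinearIndependent ℝ ![-u₁, -u₂, -u₃] :=
    linearIndependent_of_pairwise_half (neg_mem_fccSlots hu₁) (neg_mem_fccSlots hu₂) (neg_mem_fccSlots hu₃)
      (by rw [inner_neg_left, inner_neg_right, neg_neg, i12])
      (by rw [inner_neg_left, inner_neg_right, neg_neg, i13])
      (by rw [inner_neg_left, inner_neg_right, neg_neg, i23])
  have hneg₁ : ⟪G (-u₁), n⟫_ℝ ≤ 0 := by rw [map_neg, inner_neg_left, hn₁]; linarith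
  have hneg₂ : ⟪G (-u₂), n⟫_ℝ ≤ 0 := by rw [map_neg, inner_neg_left, hn₂]; linarith
  have hneg₃ : ⟪G (-u₃), n⟫_ℝ ≤ 0 := by rw [map_neg, inner_neg_left, hn₃]; linarith
  have not_deep : ∀ y ∈ X, (∀ w ∈ fccSlots, ⟪G w, n⟫_ℝ ≤ 0 → y + G w ∈ X) → ‖r y‖ ≤ 20 → y 2 < h + R₀ + 2 := by
    intro y hy hown_y hry
    by_contra hge
    push Not at hge
    exact hGne (movedFcc_eq_of_exact_neighbours_top_sf A₂ t₂ X P₂ R₀ h ρ hR₀ hρ hX hP₂X hcell hP₂ G hy hge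
      (hlat y hy hry hge) (neg_mem_fccSlots hu₁) (neg_mem_fccSlots hu₂) (neg_mem_fccSlots hu₃) hindneg
      (hown_y _ (neg_mem_fccSlots hu₁) hneg₁) (hown_y _ (neg_mem_fccSlots hu₂) hneg₂)
      (hown_y _ (neg_mem_fccSlots hu₃) hneg₃))
  -- the steered in-plane step
  have choose_step : ∀ y, ⟪r y, n⟫_ℝ = μ → ‖r y - μ • n‖ ^ 2 ≤ B →
      ∃ w ∈ fccSlots, ⟪G w, n⟫_ℝ = 0 ∧ (1 / 5 : ℝ) ≤ ⟪G w, z⟫_ℝ ∧ ‖r (y + G w) - μ • n‖ ^ 2 ≤ B := by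
    intro y hyμ hyB
    -- bookkeeping of the in-plane deviation after a step `d = G w` with `⟪d, n⟫ = 0`
    have update : ∀ w ∈ fccSlots, ⟪G w, n⟫_ℝ = 0 →
        r (y + G w) - μ • n = (r y - μ • n) + (G w - ⟪G w, z⟫_ℝ • z) ∧
        ‖G w - ⟪G w, z⟫_ℝ • z‖ ^ 2 ≤ 1 ∧ ⟪r y - μ • n, G w - ⟪G w, z⟫_ℝ • z⟫_ℝ = ⟪r y - μ • n, G w⟫_ℝ := by
      intro w hw hw0
      have hw1 : ‖G w‖ = 1 := by rw [LinearIsometryEquiv.norm_map, norm_eq_one_of_mem_fccSlots hw]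
      refine ⟨by rw [hr_add]; abel, ?_, ?_⟩
      · rw [norm_sq_perp_step hw1 hz]; linarith [sq_nonneg ⟪G w, z⟫_ℝ]
      · have hz0 : ⟪r y - μ • n, z⟫_ℝ = 0 := by
          rw [inner_sub_left, hrz y, real_inner_smul_left, real_inner_comm z n, hzn]; ring
        rw [inner_sub_right, real_inner_smul_right, hz0, mul_zero, sub_zero]
    by_cases hbig : (5 / 2 : ℝ) ≤ ‖r y - μ • n‖
    · -- steer towards the axis
      set ρℓ := ‖r y - μ • n‖ with hρℓ
      have hρℓpos : 0 < ρℓ := by linarith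
      set u : EuclideanSpace ℝ (Fin 3) := (-(1 / ρℓ)) • (r y - μ • n) with hu
      have hu1 : ‖u‖ = 1 := by
        rw [hu, norm_smul, Real.norm_eq_abs, abs_neg, abs_of_pos (by positivity : (0 : ℝ) < 1 / ρℓ), ← hρℓ]
        field_simp
      have hun : ⟪u, n⟫_ℝ = 0 := by
        rw [hu, real_inner_smul_left, inner_sub_left, hyμ, real_inner_smul_left, real_inner_self_eq_norm_sq, hn]; ring
      have hzu : ⟪z, u⟫_ℝ = 0 := by
        rw [hu, real_inner_smul_right, inner_sub_right, real_inner_comm (r y), hrz y, real_inner_smul_right, hzn]; ring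
      obtain ⟨w, hw, hw0, hwz, hwu⟩ := exists_inPlane_steering_slot G hn hmenu hz hu1 hzn hun hzu
      obtain ⟨hupd, hperp, hinner⟩ := update w hw hw0
      refine ⟨w, hw, hw0, hwz, ?_⟩
      have hin : ⟪r y - μ • n, G w⟫_ℝ ≤ -(1 / 2) := by
        have e1 : ⟪r y - μ • n, G w⟫_ℝ = -ρℓ * ⟪u, G w⟫_ℝ := by
          rw [hu, real_inner_smul_left]; field_simp
        rw [real_inner_comm] at hwu
        have h2 : (5 / 2 : ℝ) * (1 / 5) ≤ ρℓ * ⟪u, G w⟫_ℝ := mul_le_mul hbig hwu (by norm_num) (by linarith)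
        rw [e1]; linarith
      rw [hupd, norm_add_sq_real, hinner]
      linarith
    · push Not at hbig
      obtain ⟨w, hw, hw0, hwz⟩ := exists_inPlane_slot_ge G hn hmenu hz hzn
      obtain ⟨hupd, hperp, -⟩ := update w hw hw0
      refine ⟨w, hw, hw0, ?_, ?_⟩
      · have h32 : (1 / 5 : ℝ) ≤ Real.sqrt 3 / 2 := by
          rw [div_le_div_iff₀ (by norm_num) (by norm_num)]
          have : (1 : ℝ) ≤ Real.sqrt 3 := by
            rw [show (1 : ℝ) = Real.sqrt 1 by rw [Real.sqrt_one]]; exact Real.sqrt_le_sqrt (by norm_num)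
          linarith
        linarith
      · have htri := norm_add_le (r y - μ • n) (G w - ⟪G w, z⟫_ℝ • z)
        have h1 : ‖G w - ⟪G w, z⟫_ℝ • z‖ ≤ 1 := (sq_le_one_iff₀ (norm_nonneg _)).1 hperp
        rw [hupd]
        have h2 : ‖r y - μ • n + (G w - ⟪G w, z⟫_ℝ • z)‖ ≤ 7 / 2 := by linarith
        have h3 := pow_le_pow_left₀ (norm_nonneg _) h2 2
        have h4 : ((7 : ℝ) / 2) ^ 2 ≤ 13 := by norm_num
        linarith
  -- the induction
  have main : ∀ (k : ℕ) (y : EuclideanSpace ℝ (Fin 3)), y ∈ X →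
      (∀ w ∈ fccSlots, ⟪G w, n⟫_ℝ ≤ 0 → y + G w ∈ X) → (∀ w ∈ fccSlots, 0 < ⟪G w, n⟫_ℝ → y + G w ∉ X) →
      y 2 < h + R₀ + 2 → 0 ≤ ⟪y - a, z⟫_ℝ → ⟪r y, n⟫_ℝ = μ → ‖r y - μ • n‖ ^ 2 ≤ B →
      (S - ⟪y - a, z⟫_ℝ) * 5 ≤ k →
      ∃ q ∈ X, (X.filter fun y => dist q y = 1).card ≠ 12 ∧ ‖r q‖ ≤ 20 ∧ a 2 - 21 ≤ q 2 ∧ q 2 < h + R₀ + 4 := by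
    intro k
    induction k with
    | zero =>
      intro y hy hown_y _ hy2 hys hyμ hyB hbud
      exfalso
      simp only [Nat.cast_zero] at hbud
      have hμsq : μ ^ 2 ≤ 18 ^ 2 := by linarith
      have hμabs : |μ| ≤ 18 := abs_le_of_sq_le_sq hμsq (by norm_num)
      have hμe : |μ * ⟪n, e₃⟫_ℝ| ≤ 18 * 1 := by
        rw [abs_mul]; exact mul_le_mul hμabs hne₃ (abs_nonneg _) (by norm_num)
      have hb := (abs_le.1 hμe).1
      have hh := height y
      rw [hyμ] at hh
      have h1 : ⟪y - a, z⟫_ℝ * σ ≤ ⟪y - a, z⟫_ℝ * ⟪z, e₃⟫_ℝ := mul_le_mul_of_nonneg_left hσz hys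
      have hlt : ⟪y - a, z⟫_ℝ < S := by
        rw [hS, lt_div_iff₀ hσ]
        linarith
      linarith
    | succ k ih =>
      intro y hy hown_y hfar_y hy2 hys hyμ hyB hbud
      obtain ⟨w, hw, hw0, hwz, hB'⟩ := choose_step y hyμ hyB
      have hy'X : y + G w ∈ X := hown_y w hw (le_of_eq hw0)
      have hs' : ⟪y + G w - a, z⟫_ℝ = ⟪y - a, z⟫_ℝ + ⟪G w, z⟫_ℝ := by
        rw [show y + G w - a = (y - a) + G w by abel, inner_add_left]
      have hμ' : ⟪r (y + G w), n⟫_ℝ = μ := by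
        rw [hr_add, inner_add_left, hyμ, inner_sub_left, hw0, real_inner_smul_left, hzn]; ring
      have hr'norm : ‖r (y + G w)‖ ≤ 18 := by
        have h1 := pyth (y + G w) hμ'
        have h2 : ‖r (y + G w)‖ ^ 2 ≤ 18 ^ 2 := by rw [h1]; linarith
        exact (sq_le_sq₀ (norm_nonneg _) (by norm_num)).1 h2
      -- height bounds of the next ball
      have hμsq : μ ^ 2 ≤ 18 ^ 2 := by linarith
      have hμabs : |μ| ≤ 18 := abs_le_of_sq_le_sq hμsq (by norm_num)
      have hμe : |μ * ⟪n, e₃⟫_ℝ| ≤ 18 * 1 := by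
        rw [abs_mul]; exact mul_le_mul hμabs hne₃ (abs_nonneg _) (by norm_num)
      have hy'lo : a 2 - 19 ≤ (y + G w) 2 := by
        have hh := height (y + G w)
        rw [hμ'] at hh
        have hb := (abs_le.1 hμe).1
        have hs0 : 0 ≤ ⟪y + G w - a, z⟫_ℝ * ⟪z, e₃⟫_ℝ := mul_nonneg (by rw [hs']; linarith) hze₃pos.le
        linarith
      have hy'hi : (y + G w) 2 < h + R₀ + 3 := by
        have hd := abs_apply_sub_le_dist (y + G w) y 2
        have hdist : dist (y + G w) y = 1 := by
          rw [dist_eq_norm, add_sub_cancel_left, LinearIsometryEquiv.norm_map, norm_eq_one_of_mem_fccSlots hw]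
        rw [hdist] at hd
        have := (abs_le.1 hd).2
        linarith
      by_cases hsat : (X.filter fun q => dist (y + G w) q = 1).card = 12 ∧
          ∀ q ∈ X, dist (y + G w) q = 1 → q ≠ y + G w → (X.filter fun q' => dist q q' = 1).card = 12
      · -- the next ball is again a twin dozen of the plate: continue
        obtain ⟨hown', hfar'⟩ := propagate' y hy hown_y hfar_y w hw hw0 hsat.1 hsat.2
        have hy'2 : (y + G w) 2 < h + R₀ + 2 := not_deep (y + G w) hy'X hown' (by linarith)
        have hbud' : (S - ⟪y + G w - a, z⟫_ℝ) * 5 ≤ k := by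
          rw [hs']; push_cast at hbud; linarith
        exact ih (y + G w) hy'X hown' hfar' hy'2 (by rw [hs']; linarith) hμ' hB' hbud'
      · -- propagation fails: an unsaturated ball within contact distance one of the next ball
        have hpay : ∃ q ∈ X, (X.filter fun q' => dist q q' = 1).card ≠ 12 ∧ dist (y + G w) q ≤ 1 := by
          by_cases h12 : (X.filter fun q => dist (y + G w) q = 1).card = 12
          · have : ¬ ∀ q ∈ X, dist (y + G w) q = 1 → q ≠ y + G w → (X.filter fun q' => dist q q' = 1).card = 12 :=
              fun hh => hsat ⟨h12, hh⟩
            push Not at this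
            obtain ⟨q, hq, hdq, -, hq12⟩ := this
            exact ⟨q, hq, hq12, hdq.le⟩
          · exact ⟨y + G w, hy'X, h12, by rw [dist_self]; norm_num⟩
        obtain ⟨q, hq, hq12, hdq⟩ := hpay
        have hcoord := abs_apply_sub_le_dist q (y + G w) 2
        rw [dist_comm] at hcoord
        obtain ⟨hc1, hc2⟩ := abs_le.1 (hcoord.trans hdq)
        refine ⟨q, hq, hq12, ?_, by linarith, by linarith⟩
        -- lateral deviation of `q`
        have e1 : q = (y + G w) + (q - (y + G w)) := by abel
        have hv : ‖q - (y + G w)‖ ≤ 1 := by rw [← dist_eq_norm]; exact hdq.trans_eq' (dist_comm _ _)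
        rw [e1, hr_add]
        have hperp : ‖q - (y + G w) - ⟪q - (y + G w), z⟫_ℝ • z‖ ≤ 1 := by
          have h0 : ‖q - (y + G w) - ⟪q - (y + G w), z⟫_ℝ • z‖ ^ 2 ≤ 1 ^ 2 := by
            rw [norm_sub_sq_real, norm_smul, hz, mul_one, real_inner_smul_right, Real.norm_eq_abs, sq_abs]
            have hv2 : ‖q - (y + G w)‖ ^ 2 ≤ 1 := by
              have := pow_le_pow_left₀ (norm_nonneg _) hv 2; simpa using this
            linarith [sq_nonneg ⟪q - (y + G w), z⟫_ℝ]
          exact (sq_le_sq₀ (norm_nonneg _) (by norm_num)).1 h0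
        exact (norm_add_le _ _).trans (by linarith)
  -- start
  refine main ⌈(S - ⟪e - a, z⟫_ℝ) * 5⌉₊ e he hown hfar he₂ hes rfl (by rw [hB]; linarith) (Nat.le_ceil _) |>.imp
    fun q hq => ?_
  exact hq

end Summit.Ventures.Crystal3D.Theorems

end
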